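import Mathlib

/-!
# Route `ResidualThetaTransportAtTwo`, crux Kan⁺ `ThetaLayerLambdaCongruenceAtTwo` (stmt-BirchSwinnertonDyer-20688), node (G′)_N:
# TOOLS for the arithmetic of the Artin lane (Jacobi sign choice, powers of `4` modulo an Artin prime, unit lifting, the progression)

Cell `bsd-wall`, width seat `bsd-wall-rtt-p3-w4` (g0). THEOREMS ONLY (pure arithmetic of `ℤ`, `ZMod`, Jacobi symbols; no `def`, no
`sorry`); `--supports stmt-BirchSwinnertonDyer-20688`; BSD is not proved by this. This is the line-by-line version of lead `bsd-wall-rtt-p3`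
g9's sketch `Cruxes/ThetaLayerLambdaCongruenceAtTwo/Lines/birth-generation.md` §4.2, with two corrections: (i) the witness is sought in the
PARABOLIC ORBIT of the column (the literal per-`γ` statement (W_N) of `…CuspSpanConjugation` is unsatisfiable at `N = 7`, e.g. for
`γ = (29 2; 14 1)`: `(29/|2+29t|) = (±2/29) = −1`); (ii) no Legendre condition on `γ` survives — after moving to `|x| ≡ 3 (mod 4)` the two
signs `q ≡ ±c' (mod |x|)` have opposite symbols `(x/q)`, so one of them is good for EVERY column.

* §1 `jacobiSym_eq_one_of_emod_eq` — `x` odd, `|x| ≡ 3 (mod 4)`, `gcd(c', x) = 1`, `q ≡ 3 (mod 4)` prime-or-not,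
  `q ≡ −sign(x)·(c'/|x|)·c' (mod |x|)` ⟹ `(x/q) = +1` (two reciprocity signs cancel).
* §2 `exists_four_pow_eq` — `(x/q) = 1` and `2` a primitive root mod the prime `q` ⟹ `x ≡ 4^v (mod q)`;
  `coprime_orderOf_four` — `q ≡ 3 (mod 8)` and `q ≡ 2 (mod p)` for the odd primes `p ∣ n` ⟹ `gcd(ord_q 4, n) = 1`;
  `exists_exponent` — then some `k ≥ 1` with `n ∣ k` and `4^{k+v} ≡ 1 (mod q)` (CRT on exponents).
* §3 `exists_rep` — unit lifting `(ℤ/|c|M)^× ↠ (ℤ/|c|)^×` (`ZMod.unitsMap_surjective`): a representative `x ≡ a (mod c)` prime to `cM`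
  with `|x| ≡ 3 (mod 4)` (the sign of `x` is the lever when `4 ∣ c`).
* §4 `exists_progression` — the progression `r mod m`, `m = |x|·8·M`: `r ≡ r₁ (|x|)`, `r ≡ 3 (8)`, `r ≡ 2 (M)` (CRT).
The assembled statement `exists_column_kill` is in the sequel `…CuspSpanArtinArith`.

References: [Moree2012ArtinSurvey] Thms. 1–2; [Lenstra1977Artin] Thm. 8.3; [IrelandRosen1990] Ch. 5 (Jacobi reciprocity).
-/

set_option autoImplicit false
set_option linter.dupNamespace false

open NumberTheorySymbols

namespace Summit.BirchSwinnertonDyer.BirchSwinnertonDyer.Theorems.SignedMuAtTwo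

namespace CuspSpanArtin

/-! ## §1. The Jacobi-symbol sign choice -/

/-- `J(s | b) = s` for `s = ±1` and `b ≡ 3 (mod 4)` (`J(−1 | b) = χ₄(b) = −1`). [folklore] -/
theorem jacobiSym_sign_left {s : ℤ} (hs : s = 1 ∨ s = -1) {b : ℕ} (hb : b % 4 = 3) : J(s | b) = s := by
  rcases hs with rfl | rfl
  · exact jacobiSym.one_left b
  · rw [jacobiSym.at_neg_one (Nat.odd_iff.mpr (by omega)), ZMod.χ₄_nat_three_mod_four hb]

/-- **No Legendre condition survives.** Let `x` be an integer with `|x| ≡ 3 (mod 4)`, `c'` prime to `x`, and `q ≡ 3 (mod 4)` a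
natural number with `q ≡ s·c' (mod |x|)` for the sign `s = −sign(x)·(c'/|x|)`. Then the Jacobi symbol `(x/q)` is `+1`: by reciprocity
for two numbers `≡ 3 (mod 4)`, `(|x|/q) = −(q/|x|) = −(s c'/|x|) = −s·(c'/|x|)`, and `(x/q) = sign(x)·(|x|/q)`. [cite: IrelandRosen1990, Ch. 5 §2 Prop. 5.2.2] -/
theorem jacobiSym_eq_one_of_emod_eq {x c' : ℤ} {q : ℕ} (hq : q % 4 = 3) (hx : x.natAbs % 4 = 3)
    (hc : Int.gcd c' x = 1)
    (hmod : (q : ℤ) % (x.natAbs : ℤ) = (-x.sign * J(c' | x.natAbs) * c') % (x.natAbs : ℤ)) :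
    J(x | q) = 1 := by
  set b := x.natAbs with hb
  have hx0 : x ≠ 0 := by
    intro h
    rw [h, Int.natAbs_zero] at hb
    rw [hb] at hx
    norm_num at hx
  have hσ : x.sign = 1 ∨ x.sign = -1 := by
    rcases lt_or_gt_of_ne hx0 with h | h
    · exact Or.inr (Int.sign_eq_neg_one_of_neg h)
    · exact Or.inl (Int.sign_eq_one_of_pos h)
  have hJc : J(c' | b) = 1 ∨ J(c' | b) = -1 := jacobiSym.eq_one_or_neg_one (by
    have : Int.gcd c' (b : ℤ) = Int.gcd c' x := by simp [Int.gcd, b, Int.natAbs_abs]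
    rw [this]; exact hc)
  set σ := x.sign with hσdef
  set Jc := J(c' | b) with hJcdef
  have hs : (-σ * Jc) = 1 ∨ (-σ * Jc) = -1 := by
    rcases hσ with h | h <;> rcases hJc with h' | h' <;> simp [h, h']
  have hxσ : x = σ * (b : ℤ) := (Int.sign_mul_natAbs x).symm
  have h1 : J(x | q) = σ * J((b : ℤ) | q) := by
    rw [hxσ, jacobiSym.mul_left, jacobiSym_sign_left hσ hq]
  have h2 : J((b : ℤ) | q) = -J((q : ℤ) | b) := jacobiSym.quadratic_reciprocity_three_mod_four hx hq
  have h3 : J((q : ℤ) | b) = J(-σ * Jc * c' | b) := jacobiSym.mod_left' hmod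
  have h4 : J(-σ * Jc * c' | b) = (-σ * Jc) * Jc := by
    rw [jacobiSym.mul_left, jacobiSym_sign_left hs hx]
  rw [h1, h2, h3, h4]
  rcases hσ with h | h <;> rcases hJc with h' | h' <;> simp [h, h']

/-! ## §2. Powers of `4` modulo an Artin prime -/

/-- If `2` is a primitive root modulo the prime `q` and `(x/q) = +1`, then `x ≡ 4^v (mod q)` for some `v`: `x ≡ y²`, `y ≡ 2^v`.
[cite: Moree2012ArtinSurvey, §1] -/
theorem exists_four_pow_eq {q : ℕ} [hp : Fact q.Prime] (h2 : orderOf (2 : ZMod q) = q - 1) {x : ℤ}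
    (hJ : J(x | q) = 1) : ∃ v : ℕ, (4 : ZMod q) ^ v = (x : ZMod q) := by
  obtain ⟨y, hy⟩ := ZMod.isSquare_of_jacobiSym_eq_one hJ
  have hy0 : y ≠ 0 := by
    rintro rfl
    rw [mul_zero] at hy
    have hdvd : (q : ℤ) ∣ x := (ZMod.intCast_zmod_eq_zero_iff_dvd x q).mp hy
    have hz : J(x | q) = 0 := by
      rw [jacobiSym.mod_left, Int.emod_eq_zero_of_dvd hdvd]
      exact jacobiSym.zero_left hp.out.one_lt
    rw [hz] at hJ
    exact zero_ne_one hJ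
  haveI : NeZero (q - 1) := ⟨by have := hp.out.two_le; omega⟩
  have hprim : IsPrimitiveRoot (2 : ZMod q) (q - 1) := IsPrimitiveRoot.iff_orderOf.mpr h2
  obtain ⟨v, -, hv⟩ := hprim.eq_pow_of_pow_eq_one (ZMod.pow_card_sub_one_eq_one hy0)
  refine ⟨v, ?_⟩
  rw [hy, ← hv, show (4 : ZMod q) = 2 ^ 2 by norm_num, ← pow_mul]
  ring

/-- For a prime `q ≡ 3 (mod 8)` with `q ≡ 2 (mod p)` for every odd prime `p ∣ n` (`n ≥ 1`): `ord_q(4)` is positive and prime to `n`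
(`4^{(q−1)/2} = 2^{q−1} = 1`, `(q−1)/2` odd, and an odd prime `p ∣ ord_q 4` would give `q ≡ 1 (mod p)`). [cite: Moree2012ArtinSurvey, §1] -/
theorem coprime_orderOf_four {q : ℕ} [hp : Fact q.Prime] (hq : q % 8 = 3) {n : ℕ}
    (hqn : ∀ p : ℕ, p.Prime → p ∣ n → p ≠ 2 → q % p = 2 % p) :
    0 < orderOf (4 : ZMod q) ∧ Nat.Coprime (orderOf (4 : ZMod q)) n := by
  have hq3 : 3 ≤ q := by have := hp.out.two_le; omega
  have h2ne : (2 : ZMod q) ≠ 0 := by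
    intro h
    have h' : ((2 : ℕ) : ZMod q) = 0 := by exact_mod_cast h
    rw [ZMod.natCast_eq_zero_iff] at h'
    have := Nat.le_of_dvd (by norm_num) h'
    omega
  have hhalf : (4 : ZMod q) ^ ((q - 1) / 2) = 1 := by
    rw [show (4 : ZMod q) = 2 ^ 2 by norm_num, ← pow_mul, show 2 * ((q - 1) / 2) = q - 1 by omega]
    exact ZMod.pow_card_sub_one_eq_one h2ne
  have hdvd : orderOf (4 : ZMod q) ∣ (q - 1) / 2 := orderOf_dvd_of_pow_eq_one hhalf
  refine ⟨orderOf_pos_iff.mpr (isOfFinOrder_iff_pow_eq_one.mpr ⟨(q - 1) / 2, by omega, hhalf⟩), ?_⟩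
  refine Nat.coprime_of_dvd fun p pp hpo hpn ↦ ?_
  have hp2 : p ∣ (q - 1) / 2 := hpo.trans hdvd
  by_cases hp2' : p = 2
  · subst hp2'
    omega
  · have h1 := hqn p pp hpn hp2'
    have hp3 : 3 ≤ p := by have := pp.two_le; omega
    have hpq : p ∣ q - 1 := hp2.trans (Nat.div_dvd_of_dvd (by omega : 2 ∣ q - 1))
    have hq1 : q % p = 1 % p := ((Nat.modEq_iff_dvd' (by omega : 1 ≤ q)).mpr hpq).symm
    rw [h1, Nat.mod_eq_of_lt (by omega : 2 < p), Nat.mod_eq_of_lt (by omega : 1 < p)] at hq1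
    omega

/-- CRT on exponents: `gcd(ord_q 4, n) = 1`, `n ≥ 1` ⟹ some `k ≥ 1` with `n ∣ k` and `4^{k+v} ≡ 1 (mod q)`. [folklore] -/
theorem exists_exponent {q n : ℕ} (hn : 0 < n) (ho : 0 < orderOf (4 : ZMod q))
    (hco : Nat.Coprime (orderOf (4 : ZMod q)) n) (v : ℕ) :
    ∃ k : ℕ, 1 ≤ k ∧ n ∣ k ∧ (4 : ZMod q) ^ (k + v) = 1 := by
  set o := orderOf (4 : ZMod q) with ho_def
  obtain ⟨k₀, hk₀o, hk₀n⟩ := Nat.chineseRemainder hco (o - v % o) 0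
  have hvlt : v % o < o := Nat.mod_lt v ho
  have hsum : o ∣ k₀ + v := by
    have h1 : k₀ + v ≡ (o - v % o) + v % o [MOD o] := Nat.ModEq.add hk₀o (Nat.mod_modEq v o).symm
    rw [Nat.sub_add_cancel hvlt.le] at h1
    exact (Nat.modEq_zero_iff_dvd.mp (h1.trans (Nat.modEq_zero_iff_dvd.mpr dvd_rfl)))
  refine ⟨k₀ + o * n, le_add_left (Nat.mul_pos ho hn), ?_, ?_⟩
  · exact Nat.dvd_add (Nat.modEq_zero_iff_dvd.mp hk₀n) (dvd_mul_left n o)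
  · apply orderOf_dvd_iff_pow_eq_one.mp
    rw [show k₀ + o * n + v = (k₀ + v) + o * n by ring]
    exact Nat.dvd_add hsum (dvd_mul_right o n)

/-! ## §3. The representative `x ≡ a (mod c)`, prime to `cM`, with `|x| ≡ 3 (mod 4)` -/

/-- Unit lifting: for `gcd(a, c) = 1`, `4 ∣ c ≠ 0` and `M ≥ 1` there is `x ≡ a (mod c)`, prime to `c·M`, with `|x| ≡ 3 (mod 4)`
(`(ℤ/|c|M)^× → (ℤ/|c|)^×` is onto; `x ≡ a (mod 4)` is forced, the sign of `x` is chosen). [folklore] -/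
theorem exists_rep {a c : ℤ} {M : ℕ} (hM : 0 < M) (hc : c ≠ 0) (h4 : (4 : ℤ) ∣ c) (hcop : IsCoprime a c) :
    ∃ x : ℤ, c ∣ x - a ∧ IsCoprime x (c * M) ∧ x.natAbs % 4 = 3 := by
  set C := c.natAbs with hC
  have hC0 : C ≠ 0 := Int.natAbs_ne_zero.mpr hc
  set L := C * M with hL
  have hL0 : L ≠ 0 := Nat.mul_ne_zero hC0 hM.ne'
  haveI : NeZero L := ⟨hL0⟩
  haveI : NeZero C := ⟨hC0⟩
  have hCL : C ∣ L := dvd_mul_right C M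
  have hu : IsUnit ((a : ZMod C)) := by
    rw [ZMod.coe_int_isUnit_iff_isCoprime]
    have h1 : IsCoprime c a := hcop.symm
    rcases Int.natAbs_eq c with h | h
    · rw [← h]; exact h1
    · rw [show ((C : ℕ) : ℤ) = -c by omega]; exact h1.neg_left
  obtain ⟨y, hy⟩ := ZMod.unitsMap_surjective hCL hu.unit
  set xp : ℤ := (((y : ZMod L).val : ℕ) : ℤ) with hxp
  have hxp_nonneg : 0 ≤ xp := by positivity
  have hxp_lt : xp < L := by
    rw [hxp]; exact_mod_cast ZMod.val_lt (y : ZMod L)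
  have hxpC : (C : ℤ) ∣ xp - a := by
    have h1 : ((xp : ℤ) : ZMod C) = ((a : ℤ) : ZMod C) := by
      have h2 := congrArg (fun u : (ZMod C)ˣ ↦ (u : ZMod C)) hy
      simp only [ZMod.unitsMap_val, IsUnit.unit_spec] at h2
      rw [ZMod.cast_eq_val] at h2
      rw [← h2, hxp, Int.cast_natCast]
    exact (ZMod.intCast_eq_intCast_iff_dvd_sub a xp C).mp h1.symm
  have hc_dvd : c ∣ xp - a := Int.natAbs_dvd.mp hxpC
  have hcopL : Nat.Coprime (y : ZMod L).val L := ZMod.val_coe_unit_coprime y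
  have hLcM : ((L : ℕ) : ℤ) = c * M ∨ ((L : ℕ) : ℤ) = -(c * M) := by
    rcases Int.natAbs_eq c with h | h
    · left; rw [hL]; push_cast; rw [← h]
    · right; rw [hL]; push_cast; rw [show ((C : ℕ) : ℤ) = -c by omega]; ring
  have hxp_cop : IsCoprime xp (c * M) := by
    have h1 : IsCoprime xp (L : ℤ) := by
      rw [Int.isCoprime_iff_gcd_eq_one, hxp, Int.gcd_natCast_natCast]
      exact hcopL
    rcases hLcM with h | h
    · rwa [h] at h1
    · rw [h] at h1; simpa using h1.neg_right
  -- `4 ∣ c ∣ xp - a`, so `xp ≡ a (mod 4)`; `a` is odd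
  have h4xp : (4 : ℤ) ∣ xp - a := h4.trans hc_dvd
  have h4L : (4 : ℤ) ∣ (L : ℤ) := by
    rcases hLcM with h | h
    · rw [h]; exact h4.mul_right _
    · rw [h]; exact (h4.mul_right _).neg_right
  have ha_odd : ¬ (2 : ℤ) ∣ a := by
    intro h2a
    have h2c : (2 : ℤ) ∣ c := (show (2 : ℤ) ∣ 4 by norm_num).trans h4
    have := Int.isCoprime_iff_gcd_eq_one.mp hcop
    have h2 : (2 : ℤ) ∣ (Int.gcd a c : ℤ) := Int.dvd_coe_gcd h2a h2c
    rw [this] at h2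
    norm_num at h2
  by_cases ha3 : a % 4 = 3
  · refine ⟨xp, hc_dvd, hxp_cop, ?_⟩
    have : xp % 4 = 3 := by omega
    omega
  · have ha1 : a % 4 = 1 := by omega
    refine ⟨xp - L, ?_, ?_, ?_⟩
    · have : c ∣ (L : ℤ) := by
        rcases hLcM with h | h
        · rw [h]; exact dvd_mul_right c M
        · rw [h]; exact (dvd_mul_right c M).neg_right
      rw [show xp - L - a = (xp - a) - L by ring]
      exact dvd_sub hc_dvd this
    · rcases hLcM with h | h
      · rw [h, show xp - c * M = xp + (c * M) * (-1) by ring]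
        exact hxp_cop.add_mul_left_left (-1)
      · rw [h, show xp - -(c * M) = xp + (c * M) * 1 by ring]
        exact hxp_cop.add_mul_left_left 1
    · have : xp % 4 = 1 := by omega
      omega

/-! ## §4. The progression -/

/-- The progression fed to the Artin hypothesis: for `b`, `M` odd and coprime and `r₁` prime to `b` there are `m` (`8 ∣ m`) and
`r ≡ 3 (mod 8)` prime to `m` such that every `q ≡ r (mod m)` satisfies `q ≡ r₁ (mod b)`, `q ≡ 3 (mod 8)`, `q ≡ 2 (mod M)` (CRT).
[folklore] -/
theorem exists_progression (b M r₁ : ℕ) (hb : b % 2 = 1) (hM : M % 2 = 1) (hbM : Nat.Coprime b M) (hr₁ : Nat.Coprime r₁ b) :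
    ∃ m r : ℕ, 8 ∣ m ∧ r % 8 = 3 ∧ Nat.Coprime r m ∧
      ∀ q : ℕ, q % m = r % m → q % b = r₁ % b ∧ q % 8 = 3 ∧ q % M = 2 % M := by
  have h2M : Nat.Coprime 2 M := (Nat.Prime.coprime_iff_not_dvd Nat.prime_two).mpr (by omega)
  have h2b : Nat.Coprime 2 b := (Nat.Prime.coprime_iff_not_dvd Nat.prime_two).mpr (by omega)
  have co₁ : Nat.Coprime 8 M := by simpa using h2M.pow_left 3
  have co₂ : Nat.Coprime b (8 * M) := Nat.Coprime.mul_right (by simpa using (h2b.pow_left 3).symm) hbM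
  obtain ⟨k₁, hk₁8, hk₁M⟩ := Nat.chineseRemainder co₁ 3 2
  obtain ⟨r, hrb, hrk⟩ := Nat.chineseRemainder co₂ r₁ k₁
  have hr8 : r ≡ 3 [MOD 8] := (hrk.of_mul_right M).trans hk₁8
  have hrM : r ≡ 2 [MOD M] := (hrk.of_mul_left 8).trans hk₁M
  refine ⟨b * (8 * M), r, ⟨b * M, by ring⟩, ?_, ?_, fun q hq ↦ ?_⟩
  · have := hr8; unfold Nat.ModEq at this; omega
  · refine Nat.Coprime.mul_right ?_ (Nat.Coprime.mul_right ?_ ?_)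
    · rw [Nat.Coprime, hrb.gcd_eq]; exact hr₁
    · rw [Nat.Coprime, hr8.gcd_eq]; decide
    · rw [Nat.Coprime, hrM.gcd_eq]; exact h2M
  · have hq' : q ≡ r [MOD b * (8 * M)] := hq
    refine ⟨(hq'.of_mul_right _).trans hrb, ?_, ((hq'.of_mul_left b).of_mul_left 8).trans hrM⟩
    have := ((hq'.of_mul_left b).of_mul_right M).trans hr8
    unfold Nat.ModEq at this; omega

end CuspSpanArtin

end Summit.BirchSwinnertonDyer.BirchSwinnertonDyer.Theorems.SignedMuAtTwo
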